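import Summits.BirchSwinnertonDyer.BirchSwinnertonDyer.Theorems.AlignedTransportAtTwoMainConjectureOfRankZeroBSDAtTwoFineRoadCoinvCruxArch
import Summits.BirchSwinnertonDyer.BirchSwinnertonDyer.Theorems.KatoDescentPotSupersingularFineSelmerLeSelmer
import Summits.BirchSwinnertonDyer.BirchSwinnertonDyer.Theorems.ThetaPartnerAtTwoSignedKatoUpToAtTwoFineRestriction
import Mathlib.Algebra.Module.CharacterModule
import HarnessLib

/-!
# Route `AlignedTransportAtTwo`, crux C2 `MainConjectureOfRankZeroBSDAtTwo` (stmt-BirchSwinnertonDyer-22298):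
# road (b″) — the ARCHIMEDEAN BALANCE IS FUNCTORIALITY: the `Λ`-linear restriction
# `X(E/K_∞) ↠ X₀(E/K_∞)` dual to `Sel₀ ≤ Sel`, and `ℓ(ker fy) ≤ ℓ(ker fd)` from the commutative square

Width seat `bsd-line-att-p4` g2 (cell `bsd-f1-sign2`; `--supports` stmt-BirchSwinnertonDyer-22298; closes nothing).
HONEST FRAMING: THEOREMS ONLY — no definition, no named fact, no instance, no `sorry`; BSD is NOT proved by any
of this; the crux stays OPEN (it is Greenberg's `μ`-conjecture at `2` on the seed cell modulo PRINT, p583329).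

## Why this file

The lead's road (b″) (`…FineRoadCoinvCrux`, `…FineRoadCoinvCruxArch`) reads `μ(X(E/ℚ_∞)) = 0` off Kato's row
over `K_∞ = ℚ(ζ_{2^∞})` with `Δ = Gal(K_∞/ℚ_∞)`-coinvariants, a descent map `fd : X(E/K_∞)_Δ → X(E/ℚ_∞) = D.X`
(dual of the restriction `res : Sel(E/ℚ_∞) → Sel(E/K_∞)^Δ`), a fine comparison
`fy : X₀(E/K_∞)_Δ → X₀(E/ℚ_∞) = Yd.X` (dual of `res₀`), and — for `Δ_E > 0` — the displayed ARCHIMEDEAN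
BALANCE `harch : ℓ_{(2)}(ker fy) ≤ ℓ_{(2)}(ker fd)`, flagged as «Greenberg's real-place surjectivity for
`Sel^{rel}(E/ℚ_∞)`, AUDIT (β)» (cell bus 2026-08-28T02:09:05Z). This file shows that NO archimedean input is
needed: `harch` is FUNCTORIALITY plus a finite `2`-adic defect.

* `ker fd = (coker res)^∨`, `ker fy = (coker res₀)^∨` (Pontryagin duality), and the inclusion
  `Sel₀(E/K_∞) ≤ Sel(E/K_∞)` induces `coker res₀ → coker res`, whose kernel is
  `(Sel₀(K_∞)^Δ ∩ res Sel(ℚ_∞)) / res₀ Sel₀(ℚ_∞)` — classes of `Sel(E/ℚ_∞)` that become FINE over `K_∞`,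
  modulo `Sel₀(E/ℚ_∞)`. Both tree Selmer groups over `ℚ_∞` carry the SAME conditions away from `2` and at
  the infinite places (`GreenbergSelmer.infKer` / the completion condition of `IwasawaSelmer`, bridged by
  `FineSelmerLeSelmer`), so that kernel embeds in `ker(H¹(ℚ_{∞,v}, E[2^∞]) → H¹(K_{∞,w}, E[2^∞]))
  = H¹(Δ_w, E(K_{∞,w})[2^∞])` at the unique `v ∣ 2` (inflation–restriction; `Δ_w ≅ ℤ/2`,
  `E(K_{∞,w})[2^∞]` cofinitely generated) — a FINITE group. No real place enters: the real conditions of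
  `Sel` and `Sel₀` over `ℚ_∞` are identical and cancel. Dually: the restriction of
  `π_Δ : X(E/K_∞)_Δ → X₀(E/K_∞)_Δ` to `ker fd → ker fy` has FINITE COKERNEL, for either sign of `Δ_E`.
* Hence `ℓ_{(2)}(ker fy) ≤ ℓ_{(2)}(ker fd)` (`lengthAt_ker_le_of_square`, §2) and the lead's per-datum theorem
  holds with `harch` REPLACED by the commutative square `fy ∘ π_Δ = π_ℚ ∘ fd` and that finite cokernel (§3) —
  a sign-free shape for the typed witness of stub K₂″.

## What is proved

* §1 (any number field `K`, prime `p`, `ℤ_p`-extension `κ`, topological generator `γ`, ANY pinned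
  `D : W.SelmerDualData κ γ`, `Y : W.FineSelmerDualData κ γ`) — the classical analogue of the tree's signed
  `SignedKatoOffTwo.FineRestriction`: `exists_fineRestrict` (**a `Λ`-LINEAR `k : D.X → Y.X` with
  `Y.toDual (k x) = (D.toDual x) ∘ ι₀`**, `ι₀ = Sel₀ ↪ Sel` of `FineSelmerLeSelmer.fineSelmerInfty_le_selmerInfty`),
  `fineRestrict_unique`, `fineRestrict_surjective` (**onto**, Baer), `fineRestrict_eq_zero_iff` (kernel = characters
  vanishing on `Sel₀`, the dual of `Sel/Sel₀`), `lengthAt_eq_lengthAt_ker_fineRestrict_add`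
  (`ℓ_𝔭(X) = ℓ_𝔭(ker k) + ℓ_𝔭(X₀)`), `lengthAt_fine_le_lengthAt_selmer`, `isTorsion_fine_of_isTorsion_selmer`,
  `moduleFinite_fine_of_moduleFinite_selmer`, `muInvariant_fine_le_mu` (**`μ(X₀(E/K_∞)) ≤ μ(X(E/K_∞))`** for
  `X` f.g. torsion), `exists_fineRestrict_package`.
* §2 (any commutative ring, any prime `𝔭`) `lengthAt_ker_le_of_square`: for a commutative square
  `fy ∘ πΔ = πX ∘ fd`, `πΔ(ker fd) ≤ ker fy` and `ℓ_𝔭(ker fy) ≤ ℓ_𝔭(ker fd)` as soon as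
  `ℓ_𝔭(ker fy / πΔ(ker fd)) = 0`.
* §3 (`p = 2`, the tree's objects over `ℚ`) `selmerDual_mu_eq_zero_of_roadB2_square_two`: the lead's
  `selmerDual_mu_eq_zero_of_roadB2_arch_two` with `harch` discharged from the square data; and
  `harch_of_square_two`, the balance itself.

References: R. Greenberg, LNM 1716 (1999), §1 (p. 60: `Λ`-module structure of Pontryagin duals), §3
(restriction along `K_∞/ℚ_∞`); J. Coates, R. Sujatha, Math. Ann. 331 (2005), §3 (`R(E/F_∞) ⊂ S(E/F_∞)`);
K. Kato, Astérisque 295 (2004), §17.13; L. Washington, GTM 83, §13.2.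
-/

set_option autoImplicit false
-- the Theorems namespace of this sub repeats the summit name by design (D-0017 nested layout)
set_option linter.dupNamespace false

noncomputable section

open scoped Classical

namespace Summit.BirchSwinnertonDyer.BirchSwinnertonDyer.Theorems.AlignedTransportAtTwoFineRoad

/-! ## §1 The restriction `k : X(E/K_∞) ↠ X₀(E/K_∞)` on the pinned duals -/

namespace FineRestrict

open WeierstrassCurve Literature.NumberTheory.EllipticCurves Literature.NumberTheory.EllipticCurves.IwasawaDual
  Literature.NumberTheory.EllipticCurves.Module Literature.NumberTheory.GaloisRepresentations ZpExtension
  Summit.BirchSwinnertonDyer.BirchSwinnertonDyer.Theorems.IsogenyMuShift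

universe u

variable {K : Type u} [Field K] [NumberField K] (W : WeierstrassCurve K) {p : ℕ} [Fact p.Prime]
  (κ : ZpExtension K p) {γ : Field.absoluteGaloisGroup K}

/-- The inclusion `ι₀ : Sel₀(K_∞, E[p^∞]) → Sel_{p^∞}(E/K_∞)` (`FineSelmerLeSelmer.fineSelmerInfty_le_selmerInfty`)
commutes with `conj_γ` (both are restrictions of `conj_γ` on `H¹(K_∞, E[p^∞])`). [cite: CoatesSujatha2005, §3] -/
theorem inclusion_conjFineSelmerInfty (γ : Field.absoluteGaloisGroup K) (s : W.fineSelmerInfty κ) :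
    AddSubgroup.inclusion (FineSelmerLeSelmer.fineSelmerInfty_le_selmerInfty W κ) (W.conjFineSelmerInfty κ γ s) =
      W.conjSelmerInfty κ γ (AddSubgroup.inclusion (FineSelmerLeSelmer.fineSelmerInfty_le_selmerInfty W κ) s) :=
  Subtype.ext rfl

/-- `ι₀` intertwines `ψ₀ = conj_γ − 1` on `Sel₀` with `ψ = conj_γ − 1` on `Sel`. [cite: CoatesSujatha2005, §3] -/
theorem inclusion_conjFineSelmerInfty_sub_one (γ : Field.absoluteGaloisGroup K) (s : W.fineSelmerInfty κ) :
    AddSubgroup.inclusion (FineSelmerLeSelmer.fineSelmerInfty_le_selmerInfty W κ)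
        ((W.conjFineSelmerInfty κ γ - 1) s) =
      (W.conjSelmerInfty κ γ - 1)
        (AddSubgroup.inclusion (FineSelmerLeSelmer.fineSelmerInfty_le_selmerInfty W κ) s) := by
  rw [IwasawaDual.End_sub_apply, IwasawaDual.End_sub_apply, AddMonoid.End.one_apply, AddMonoid.End.one_apply,
    map_sub, inclusion_conjFineSelmerInfty]

/-- **The restriction map exists.** For a topological generator `γ`, any pinned `D : W.SelmerDualData κ γ` and
`Y : W.FineSelmerDualData κ γ`, there is a `Λ`-LINEAR `k : D.X → Y.X` with `Y.toDual (k x) = (D.toDual x) ∘ ι₀` —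
the Pontryagin dual `X(E/K_∞) → X₀(E/K_∞)` of `Sel₀ ≤ Sel`. `Λ`-linearity: both actions read through `toDual` are
the canonical ones (`SelmerDualData.toDual_smul`, `SignedKatoOffTwo.FineRestriction.fineDual_toDual_smul`), natural
along `ι₀` (`IsLocNil.smulFun_comp`). [cite: GreenbergLNM1716, §1 (after Conj. 1.3)] [cite: CoatesSujatha2005, §3] -/
theorem exists_fineRestrict (hγ : κ.IsTopGenerator γ) (D : W.SelmerDualData κ γ) (Y : W.FineSelmerDualData κ γ) :
    ∃ k : D.X →ₗ[IwasawaAlgebra p] Y.X, ∀ (x : D.X) (s : W.fineSelmerInfty κ),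
      Y.toDual (k x) s =
        D.toDual x (AddSubgroup.inclusion (FineSelmerLeSelmer.fineSelmerInfty_le_selmerInfty W κ) s) := by
  set ι₀ : W.fineSelmerInfty κ →+ W.selmerInfty κ :=
    AddSubgroup.inclusion (FineSelmerLeSelmer.fineSelmerInfty_le_selmerInfty W κ) with hι₀
  set eY := AddEquiv.ofBijective Y.toDual Y.bijective with heY
  have heY_apply : ∀ χ, Y.toDual (eY.symm χ) = χ := fun χ ↦ eY.apply_symm_apply χ
  refine ⟨{ toFun := fun x ↦ eY.symm ((D.toDual x).comp ι₀)
            map_add' := fun x y ↦ by rw [map_add, AddMonoidHom.add_comp, map_add]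
            map_smul' := fun f x ↦ ?_ }, fun x s ↦ ?_⟩
  · apply Y.bijective.injective
    rw [RingHom.id_apply, heY_apply, SignedKatoOffTwo.FineRestriction.fineDual_toDual_smul W κ hγ Y, heY_apply,
      D.toDual_smul,
      IsLocNil.smulFun_comp (W.isLocNil_conjFineSelmerInfty_sub_one κ hγ)
        (W.isLocNil_conjSelmerInfty_sub_one' κ γ) ι₀
        (fun s ↦ inclusion_conjFineSelmerInfty_sub_one W κ γ s)]
  · show Y.toDual (eY.symm ((D.toDual x).comp ι₀)) s = _
    rw [heY_apply, AddMonoidHom.comp_apply]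

/-- **Uniqueness**: two `k`'s compatible with the `toDual`'s agree (`Y.toDual` is injective). [folklore] -/
theorem fineRestrict_unique (D : W.SelmerDualData κ γ) (Y : W.FineSelmerDualData κ γ)
    (k k' : D.X →ₗ[IwasawaAlgebra p] Y.X)
    (hk : ∀ (x : D.X) (s : W.fineSelmerInfty κ), Y.toDual (k x) s =
      D.toDual x (AddSubgroup.inclusion (FineSelmerLeSelmer.fineSelmerInfty_le_selmerInfty W κ) s))
    (hk' : ∀ (x : D.X) (s : W.fineSelmerInfty κ), Y.toDual (k' x) s =
      D.toDual x (AddSubgroup.inclusion (FineSelmerLeSelmer.fineSelmerInfty_le_selmerInfty W κ) s)) :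
    k = k' := by
  refine LinearMap.ext fun x ↦ Y.bijective.injective (AddMonoidHom.ext fun s ↦ ?_)
  rw [hk, hk']

/-- **`k : X ↠ X₀` is ONTO**: every character of `Sel₀(K_∞)` extends to `Sel(E/K_∞)` along the injective `ι₀`,
because `ℚ/ℤ` is divisible (Mathlib: `CharacterModule.dual_surjective_of_injective`, Baer).
[cite: GreenbergLNM1716, §1 (after Conj. 1.3)] -/
theorem fineRestrict_surjective (D : W.SelmerDualData κ γ) (Y : W.FineSelmerDualData κ γ)
    (k : D.X →ₗ[IwasawaAlgebra p] Y.X)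
    (hk : ∀ (x : D.X) (s : W.fineSelmerInfty κ), Y.toDual (k x) s =
      D.toDual x (AddSubgroup.inclusion (FineSelmerLeSelmer.fineSelmerInfty_le_selmerInfty W κ) s)) :
    Function.Surjective k := by
  intro y
  set ι₀ : W.fineSelmerInfty κ →+ W.selmerInfty κ :=
    AddSubgroup.inclusion (FineSelmerLeSelmer.fineSelmerInfty_le_selmerInfty W κ) with hι₀
  have hinj : Function.Injective ι₀.toIntLinearMap :=
    AddSubgroup.inclusion_injective (FineSelmerLeSelmer.fineSelmerInfty_le_selmerInfty W κ)
  obtain ⟨L, hL⟩ := CharacterModule.dual_surjective_of_injective (R := ℤ) ι₀.toIntLinearMap hinj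
    (Y.toDual y : CharacterModule (W.fineSelmerInfty κ))
  obtain ⟨x, hx⟩ := D.bijective.surjective (L : W.selmerInfty κ →+ AddCircle (1 : ℚ))
  refine ⟨x, Y.bijective.injective (AddMonoidHom.ext fun s ↦ ?_)⟩
  rw [hk, hx]
  have := congrArg (fun χ : CharacterModule (W.fineSelmerInfty κ) ↦ χ s) hL
  simp only [CharacterModule.dual_apply] at this
  exact this

/-- **The kernel of `k`**: `k x = 0` iff the character `D.toDual x` of `Sel(E/K_∞)` VANISHES ON `Sel₀(K_∞, E[p^∞])`
— `ker k` is the Pontryagin dual of `Sel/Sel₀`, the part controlled by the local condition at `p` (and nothing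
at the infinite places, where `Sel` and `Sel₀` carry the same condition). [cite: CoatesSujatha2005, §3] -/
theorem fineRestrict_eq_zero_iff (D : W.SelmerDualData κ γ) (Y : W.FineSelmerDualData κ γ)
    (k : D.X →ₗ[IwasawaAlgebra p] Y.X)
    (hk : ∀ (x : D.X) (s : W.fineSelmerInfty κ), Y.toDual (k x) s =
      D.toDual x (AddSubgroup.inclusion (FineSelmerLeSelmer.fineSelmerInfty_le_selmerInfty W κ) s))
    (x : D.X) :
    k x = 0 ↔ ∀ s : W.fineSelmerInfty κ,
      D.toDual x (AddSubgroup.inclusion (FineSelmerLeSelmer.fineSelmerInfty_le_selmerInfty W κ) s) = 0 := by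
  constructor
  · intro h s
    rw [← hk, h, map_zero, AddMonoidHom.zero_apply]
  · intro h
    have h0 : Y.toDual (k x) = Y.toDual 0 := by
      rw [map_zero]
      exact AddMonoidHom.ext fun s ↦ by rw [hk, h, AddMonoidHom.zero_apply]
    exact Y.bijective.injective h0

/-- **Length bookkeeping**: `ℓ_𝔭(X) = ℓ_𝔭(ker k) + ℓ_𝔭(X₀)` at every prime `𝔭` of `Λ` (additivity on
`0 → ker k → D.X → Y.X → 0`). [cite: GreenbergLNM1716, §1 (after Conj. 1.3)] -/
theorem lengthAt_eq_lengthAt_ker_fineRestrict_add (D : W.SelmerDualData κ γ) (Y : W.FineSelmerDualData κ γ)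
    (k : D.X →ₗ[IwasawaAlgebra p] Y.X)
    (hk : ∀ (x : D.X) (s : W.fineSelmerInfty κ), Y.toDual (k x) s =
      D.toDual x (AddSubgroup.inclusion (FineSelmerLeSelmer.fineSelmerInfty_le_selmerInfty W κ) s))
    (𝔭 : PrimeSpectrum (IwasawaAlgebra p)) :
    lengthAt (IwasawaAlgebra p) D.X 𝔭 =
      lengthAt (IwasawaAlgebra p) (LinearMap.ker k) 𝔭 + lengthAt (IwasawaAlgebra p) Y.X 𝔭 :=
  lengthAt_eq_add_of_exact (LinearMap.ker k).subtype k (Submodule.injective_subtype _)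
    (fineRestrict_surjective W κ D Y k hk) (LinearMap.exact_subtype_ker_map k) 𝔭

/-- `ℓ_𝔭(X₀(E/K_∞)) ≤ ℓ_𝔭(X(E/K_∞))` for every prime `𝔭` of `Λ` (the restriction is onto).
[cite: CoatesSujatha2005, §3] -/
theorem lengthAt_fine_le_lengthAt_selmer (hγ : κ.IsTopGenerator γ) (D : W.SelmerDualData κ γ)
    (Y : W.FineSelmerDualData κ γ) (𝔭 : PrimeSpectrum (IwasawaAlgebra p)) :
    lengthAt (IwasawaAlgebra p) Y.X 𝔭 ≤ lengthAt (IwasawaAlgebra p) D.X 𝔭 := by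
  obtain ⟨k, hk⟩ := exists_fineRestrict W κ hγ D Y
  exact lengthAt_le_of_surjective k (fineRestrict_surjective W κ D Y k hk) 𝔭

/-- **`X₀(E/K_∞)` is `Λ`-torsion whenever `X(E/K_∞)` is** (image of a torsion module under the onto `Λ`-linear
`k`). [cite: CoatesSujatha2005, §3] -/
theorem isTorsion_fine_of_isTorsion_selmer (hγ : κ.IsTopGenerator γ) (D : W.SelmerDualData κ γ)
    (Y : W.FineSelmerDualData κ γ) (hD : D.IsTorsion) :
    Module.IsTorsion (IwasawaAlgebra p) Y.X := by
  obtain ⟨k, hk⟩ := exists_fineRestrict W κ hγ D Y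
  intro y
  obtain ⟨x, rfl⟩ := fineRestrict_surjective W κ D Y k hk y
  obtain ⟨a, ha⟩ := @hD x
  have ha' : (a : IwasawaAlgebra p) • x = 0 := ha
  exact ⟨a, show (a : IwasawaAlgebra p) • k x = 0 by rw [← map_smul, ha', map_zero]⟩

/-- **`X₀(E/K_∞)` is finitely generated over `Λ` whenever `X(E/K_∞)` is** (image under the onto `k`).
[cite: CoatesSujatha2005, §3] -/
theorem moduleFinite_fine_of_moduleFinite_selmer (hγ : κ.IsTopGenerator γ) (D : W.SelmerDualData κ γ)
    (Y : W.FineSelmerDualData κ γ) [Module.Finite (IwasawaAlgebra p) D.X] :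
    Module.Finite (IwasawaAlgebra p) Y.X := by
  obtain ⟨k, hk⟩ := exists_fineRestrict W κ hγ D Y
  exact Module.Finite.of_surjective k (fineRestrict_surjective W κ D Y k hk)

/-- **`μ(X₀(E/K_∞)) ≤ μ(X(E/K_∞))`** for `X(E/K_∞)` finitely generated and torsion (so that both local lengths at
`(p)` are finite and the `toNat`'s compare). [cite: CoatesSujatha2005, §3 (Conjecture A vs. μ = 0)] -/
theorem muInvariant_fine_le_mu (hγ : κ.IsTopGenerator γ) (D : W.SelmerDualData κ γ)
    (Y : W.FineSelmerDualData κ γ) [Module.Finite (IwasawaAlgebra p) D.X] (hD : D.IsTorsion) :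
    muInvariant p Y.X ≤ D.mu := by
  let 𝔭 : PrimeSpectrum (IwasawaAlgebra p) :=
    ⟨IwasawaAlgebra.augIdealP p, IwasawaAlgebra.isPrime_augIdealP_holds p⟩
  change muInvariant p Y.X ≤ muInvariant p D.X
  rw [muInvariant_eq_toNat_lengthAt p Y.X 𝔭 rfl, muInvariant_eq_toNat_lengthAt p D.X 𝔭 rfl]
  exact ENat.toNat_le_toNat (lengthAt_fine_le_lengthAt_selmer W κ hγ D Y 𝔭)
    (lengthAt_ne_top_of_isTorsion p D.X hD 𝔭 rfl)

/-- **The restriction packaged**: for `γ` a topological generator and ANY pinned `D : W.SelmerDualData κ γ`,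
`Y : W.FineSelmerDualData κ γ` there is a `Λ`-linear `k : D.X → Y.X`, compatible with the `toDual`'s along
`Sel₀ ≤ Sel`, ONTO, with `ker k = {x | D.toDual x vanishes on Sel₀}` and `ℓ_𝔭(D.X) = ℓ_𝔭(ker k) + ℓ_𝔭(Y.X)` for
all `𝔭`. [cite: GreenbergLNM1716, §1 (after Conj. 1.3)] [cite: CoatesSujatha2005, §3] -/
theorem exists_fineRestrict_package (hγ : κ.IsTopGenerator γ) (D : W.SelmerDualData κ γ)
    (Y : W.FineSelmerDualData κ γ) :
    ∃ k : D.X →ₗ[IwasawaAlgebra p] Y.X,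
      (∀ (x : D.X) (s : W.fineSelmerInfty κ), Y.toDual (k x) s =
        D.toDual x (AddSubgroup.inclusion (FineSelmerLeSelmer.fineSelmerInfty_le_selmerInfty W κ) s)) ∧
      Function.Surjective k ∧
      (∀ x : D.X, k x = 0 ↔ ∀ s : W.fineSelmerInfty κ,
        D.toDual x (AddSubgroup.inclusion (FineSelmerLeSelmer.fineSelmerInfty_le_selmerInfty W κ) s) = 0) ∧
      ∀ 𝔭 : PrimeSpectrum (IwasawaAlgebra p),
        lengthAt (IwasawaAlgebra p) D.X 𝔭 =
          lengthAt (IwasawaAlgebra p) (LinearMap.ker k) 𝔭 + lengthAt (IwasawaAlgebra p) Y.X 𝔭 := by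
  obtain ⟨k, hk⟩ := exists_fineRestrict W κ hγ D Y
  exact ⟨k, hk, fineRestrict_surjective W κ D Y k hk, fun x ↦ fineRestrict_eq_zero_iff W κ D Y k hk x,
    fun 𝔭 ↦ lengthAt_eq_lengthAt_ker_fineRestrict_add W κ D Y k hk 𝔭⟩

end FineRestrict

/-! ## §2 The balance from a commutative square (pure module algebra) -/

section Square

open Literature.NumberTheory.EllipticCurves.Module

variable {R : Type*} [CommRing R] {XΔ X YΔ Y : Type*}
  [AddCommGroup XΔ] [_root_.Module R XΔ] [AddCommGroup X] [_root_.Module R X]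
  [AddCommGroup YΔ] [_root_.Module R YΔ] [AddCommGroup Y] [_root_.Module R Y]

/-- In a commutative square `fy ∘ πΔ = πX ∘ fd`, `πΔ` carries `ker fd` into `ker fy`. [folklore] -/
theorem map_ker_le_ker_of_square (fd : XΔ →ₗ[R] X) (fy : YΔ →ₗ[R] Y) (πΔ : XΔ →ₗ[R] YΔ) (πX : X →ₗ[R] Y)
    (hsq : fy ∘ₗ πΔ = πX ∘ₗ fd) : (LinearMap.ker fd).map πΔ ≤ LinearMap.ker fy := by
  intro y hy
  obtain ⟨x, hx, rfl⟩ := Submodule.mem_map.mp hy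
  rw [LinearMap.mem_ker] at hx ⊢
  rw [← LinearMap.comp_apply, hsq, LinearMap.comp_apply, hx, map_zero]

/-- **The balance from the square.** For a commutative square `fy ∘ πΔ = πX ∘ fd` of `R`-linear maps and a
prime `𝔭`: if the image `πΔ(ker fd) ≤ ker fy` has a cokernel of local length `0` at `𝔭`, then
`ℓ_𝔭(ker fy) ≤ ℓ_𝔭(ker fd)` (`ℓ(ker fy) = ℓ(πΔ(ker fd)) + 0` and `ker fd ↠ πΔ(ker fd)`). In road (b″):
`fd`/`fy` the duals of `res`/`res₀` along `K_∞/ℚ_∞`, `πΔ`/`πX` the duals of `Sel₀ ≤ Sel` over `K_∞`/`ℚ_∞`, and the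
cokernel is dual to the classes of `Sel(E/ℚ_∞)` that become fine over `K_∞` modulo `Sel₀(E/ℚ_∞)` — a
subquotient of `H¹(Δ_w, E(K_{∞,w})[2^∞])`, finite. [folklore] -/
theorem lengthAt_ker_le_of_square (fd : XΔ →ₗ[R] X) (fy : YΔ →ₗ[R] Y) (πΔ : XΔ →ₗ[R] YΔ) (πX : X →ₗ[R] Y)
    (hsq : fy ∘ₗ πΔ = πX ∘ₗ fd) (𝔭 : PrimeSpectrum R)
    (hdef : lengthAt R ((LinearMap.ker fy) ⧸
      ((LinearMap.ker fd).map πΔ).comap (LinearMap.ker fy).subtype) 𝔭 = 0) :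
    lengthAt R (LinearMap.ker fy) 𝔭 ≤ lengthAt R (LinearMap.ker fd) 𝔭 := by
  have hle := map_ker_le_ker_of_square fd fy πΔ πX hsq
  have hmaps : ∀ x ∈ LinearMap.ker fd, πΔ x ∈ LinearMap.ker fy :=
    fun x hx ↦ hle (Submodule.mem_map_of_mem hx)
  set N : Submodule R (LinearMap.ker fy) := ((LinearMap.ker fd).map πΔ).comap (LinearMap.ker fy).subtype
    with hN
  -- `g : ker fd → ker fy`, the restriction of `πΔ`, has range `N`
  let g : LinearMap.ker fd →ₗ[R] LinearMap.ker fy := πΔ.restrict hmaps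
  have hrange : LinearMap.range g = N := by
    ext y
    constructor
    · rintro ⟨x, rfl⟩
      exact Submodule.mem_comap.mpr (Submodule.mem_map_of_mem (f := πΔ) x.2)
    · intro hy
      obtain ⟨x, hx, hxy⟩ := Submodule.mem_map.mp (Submodule.mem_comap.mp hy)
      exact ⟨⟨x, hx⟩, Subtype.ext hxy⟩
  rw [lengthAt_eq_add_quotient N 𝔭, hdef, add_zero, ← hrange]
  exact lengthAt_le_of_surjective g.rangeRestrict g.surjective_rangeRestrict 𝔭

end Square

/-! ## §3 Road (b″) per datum at `2`: the archimedean balance discharged from the square -/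

section AtTwo

open Literature.NumberTheory.EllipticCurves Literature.NumberTheory.EllipticCurves.Module WeierstrassCurve
  Summit.BirchSwinnertonDyer.Rank1Residual.X1.MuLambda

variable (W : WeierstrassCurve ℚ) {κ : ZpExtension ℚ 2} {γ : Field.absoluteGaloisGroup ℚ}

/-- **The archimedean balance of road (b″) is functoriality**: for the tree's `D : SelmerDualData` (`X(E/ℚ_∞)`),
`Yd : FineSelmerDualData` (`X₀(E/ℚ_∞)`), any `Λ`-linear `fd : X'_Δ → D.X`, `fy : Y'_Δ → Yd.X` sitting in a
commutative square `fy ∘ πΔ = πℚ ∘ fd` (in the model: `πΔ` induced on `Δ`-coinvariants by `X(E/K_∞) ↠ X₀(E/K_∞)`,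
`πℚ` the restriction `k` of §1) whose restriction `ker fd → ker fy` has FINITE cokernel (the dual of the `2`-adic
inflation–restriction defect, finite for BOTH signs of `Δ_E`): `ℓ_{(2)}(ker fy) ≤ ℓ_{(2)}(ker fd)` — the hypothesis
`harch` of `selmerDual_mu_eq_zero_of_roadB2_arch_two`, with no real place involved.
[cite: GreenbergLNM1716, §3 (restriction along the cyclotomic tower)] [cite: CoatesSujatha2005, §3] -/
theorem harch_of_square_two (D : W.SelmerDualData κ γ) (Yd : W.FineSelmerDualData κ γ)
    {XΔ YΔ : Type*} [AddCommGroup XΔ] [_root_.Module (IwasawaAlgebra 2) XΔ]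
    [AddCommGroup YΔ] [_root_.Module (IwasawaAlgebra 2) YΔ]
    (fd : XΔ →ₗ[IwasawaAlgebra 2] D.X) (fy : YΔ →ₗ[IwasawaAlgebra 2] Yd.X)
    (πΔ : XΔ →ₗ[IwasawaAlgebra 2] YΔ) (πℚ : D.X →ₗ[IwasawaAlgebra 2] Yd.X) (hsq : fy ∘ₗ πΔ = πℚ ∘ₗ fd)
    (hdef : Finite ((LinearMap.ker fy) ⧸ ((LinearMap.ker fd).map πΔ).comap (LinearMap.ker fy).subtype)) :
    lengthAt (IwasawaAlgebra 2) (LinearMap.ker fy)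
        ⟨IwasawaAlgebra.augIdealP 2, IwasawaAlgebra.isPrime_augIdealP_holds 2⟩ ≤
      lengthAt (IwasawaAlgebra 2) (LinearMap.ker fd)
        ⟨IwasawaAlgebra.augIdealP 2, IwasawaAlgebra.isPrime_augIdealP_holds 2⟩ := by
  haveI := hdef
  exact lengthAt_ker_le_of_square fd fy πΔ πℚ hsq _ (lengthAt_augIdealP_eq_zero_of_finite 2 _ _ rfl)

/-- **ROAD (b″) PER CYCLOTOMIC DATUM, BOTH SIGNS OF `Δ_E`, NO ARCHIMEDEAN INPUT.** As the lead's
`selmerDual_mu_eq_zero_of_roadB2_arch_two` (statement (A) at `(E,2)` over `ℚ`, even-branch `μ₂ = 0`, the displayed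
Kato data over `ℚ(ζ_{2^∞})` with `Δ`-action and finite Coleman cokernel, even-branch value `a + b = s·G`,
`X(E/K_∞)` f.g. torsion, descent `fd` with finite cokernel, fine comparison `fy`), with the archimedean balance
REPLACED by the commutative square `fy ∘ πΔ = πℚ ∘ fd` and the finiteness of the cokernel of `ker fd → ker fy`
⟹ `μ(X(E/ℚ_∞)) = 0`. [cite: Kato2004Asterisque, Thm. 17.4 (1), Prop. 17.11, §17.13 (pp. 273–280)]
[cite: GreenbergLNM1716, §3] [cite: CoatesSujatha2005, statement (A) (§3)] -/
theorem selmerDual_mu_eq_zero_of_roadB2_square_two (hγ : κ.IsTopGenerator γ) (D : W.SelmerDualData κ γ)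
    (Yd : W.FineSelmerDualData κ γ) (hA : Set.Finite {s : W.fineSelmerInfty κ | 2 • s = 0})
    {G : IwasawaAlgebra 2} (hred : red G ≠ 0)
    {P X' Y' : Type*} [AddCommGroup P] [_root_.Module (IwasawaAlgebra 2) P]
    [AddCommGroup X'] [_root_.Module (IwasawaAlgebra 2) X']
    [AddCommGroup Y'] [_root_.Module (IwasawaAlgebra 2) Y']
    (toX : P →ₗ[IwasawaAlgebra 2] X') (π : X' →ₗ[IwasawaAlgebra 2] Y') (hX : Function.Exact toX π)
    (hπ : Function.Surjective π) (cP : P →ₗ[IwasawaAlgebra 2] P) (cX : X' →ₗ[IwasawaAlgebra 2] X')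
    (cY : Y' →ₗ[IwasawaAlgebra 2] Y') (hcX : toX ∘ₗ cP = cX ∘ₗ toX) (hcY : π ∘ₗ cX = cY ∘ₗ π)
    (col : P →ₗ[IwasawaAlgebra 2] IwasawaAlgebra 2 × IwasawaAlgebra 2) (hcol : Function.Injective col)
    (hccol : col ∘ₗ cP = (LinearEquiv.prodComm (IwasawaAlgebra 2) (IwasawaAlgebra 2) (IwasawaAlgebra 2) :
      IwasawaAlgebra 2 × IwasawaAlgebra 2 →ₗ[IwasawaAlgebra 2] IwasawaAlgebra 2 × IwasawaAlgebra 2) ∘ₗ col)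
    (hfin : Finite ((IwasawaAlgebra 2 × IwasawaAlgebra 2) ⧸ LinearMap.range col))
    {w₁ w₂ : P} (h₁ : toX w₁ = 0) (h₂ : toX w₂ = 0) {a b s : IwasawaAlgebra 2} (hw₁ : col w₁ = (a, b))
    (hw₂ : col w₂ = (b, a)) (hs : s ∉ IwasawaAlgebra.augIdealP 2) (hab : a + b = s * G)
    (hXfg : Module.Finite (IwasawaAlgebra 2) X') (hXt : Module.IsTorsion (IwasawaAlgebra 2) X')
    (fd : (X' ⧸ LinearMap.range (cX - 1)) →ₗ[IwasawaAlgebra 2] D.X)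
    (hfd : Finite (D.X ⧸ LinearMap.range fd))
    (fy : (Y' ⧸ LinearMap.range (cY - 1)) →ₗ[IwasawaAlgebra 2] Yd.X)
    (πΔ : (X' ⧸ LinearMap.range (cX - 1)) →ₗ[IwasawaAlgebra 2] (Y' ⧸ LinearMap.range (cY - 1)))
    (πℚ : D.X →ₗ[IwasawaAlgebra 2] Yd.X) (hsq : fy ∘ₗ πΔ = πℚ ∘ₗ fd)
    (hdef : Finite ((LinearMap.ker fy) ⧸ ((LinearMap.ker fd).map πΔ).comap (LinearMap.ker fy).subtype)) :
    D.mu = 0 :=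
  selmerDual_mu_eq_zero_of_roadB2_arch_two W hγ D Yd hA hred toX π hX hπ cP cX cY hcX hcY col hcol hccol hfin
    h₁ h₂ hw₁ hw₂ hs hab hXfg hXt fd hfd fy (harch_of_square_two W D Yd fd fy πΔ πℚ hsq hdef)

end AtTwo

end Summit.BirchSwinnertonDyer.BirchSwinnertonDyer.Theorems.AlignedTransportAtTwoFineRoad

end
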